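import Literature.RingTheory.Flat.FiniteRegularFree
import Literature.RingTheory.IntegralClosure.InvariantGoingDown
import Literature.AlgebraicGeometry.Morphisms.QuasiFiniteStalkPrimary
import HarnessLib

/-!
# A regular ring is flat over a regular ring of invariants of a finite group
# (miracle flatness for `B^G ⊆ B`: Matsumura 23.1 + going-down for rings of invariants)

Topic `Literature/RingTheory/Flat`; namespace `Literature.RingTheory.Flat`.  THEOREMS ONLY.  Cell hodgecm-mathlib,
fan B, row VI-5 (`AlbaneseTraceOfFiniteQuotient`), package P1 «the finite quotient `X → X/Δ` is flat (finite locally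
free) when `X` and `X/Δ` are smooth», ring form:

* `flat_of_isInvariant_of_isRegularLocalRing` — let a finite group `G` act on a Noetherian ring `B` and let
  `A ⊆ B` be a ring of invariants (`Algebra.IsInvariant A B G`) with `B` finite over `A`.  If all localizations of
  `A` and of `B` at primes are REGULAR local rings, then `B` is flat over `A`.  PROOF, prime by prime on `B`
  (Mathlib `RingHom.Flat.ofLocalizationPrime`): at `𝔮` over `𝔭 = 𝔮 ∩ A`, `A_𝔭 → B_𝔮` is a local homomorphism of
  regular local rings; `dim B_𝔮 = ht 𝔮 = ht 𝔭 = dim A_𝔭` because rings of invariants have GOING-DOWN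
  (`IntegralClosure.InvariantGoingDown.hasGoingDown`, Lipman–Hashimoto Lemma 32.2) and `B` is integral over `A`
  (`KrullDimension.height_under_eq`); `𝔭 B_𝔮` is `𝔮B_𝔮`-primary since `B` is quasi-finite over `A`
  (`Morphisms.exists_maximalIdeal_pow_le_map_of_quasiFinite`); so Matsumura 23.1
  (`flat_of_isRegularLocalRing_of_maximalIdeal_pow_le`) gives flatness of `B_𝔮` over `A_𝔭`.

With `B` finite over `A`, flat means finite locally free: the quotient map `Spec B → Spec B^G` is finite locally
free of rank `|G|` over the locus where `G` acts faithfully… (not recorded here).  HC_CM is proved only modulo the 7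
printed citations until rung 0 closes; nothing here changes that.

## References
* [Matsumura1987] H. Matsumura, *Commutative Ring Theory*, CUP 1986, Thm. 23.1; Thm. 9.4 (going down).
* [LipmanHashimoto2009] J. Lipman, M. Hashimoto, *Foundations of Grothendieck Duality for Diagrams of Schemes*,
  LNM 1960 (2009), Part II Lemma 32.2 (going-down for rings of invariants).
* The Stacks Project, Tag 00R4.
-/

noncomputable section

open IsLocalRing

universe u

namespace Literature.RingTheory.Flat

/-- **A regular ring is flat over a regular ring of invariants of a finite group.**  For a finite group `G`
acting on a Noetherian ring `B`, a ring of invariants `A ⊆ B` (`Algebra.IsInvariant A B G`) over which `B` is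
finite, and all localizations of `A` and `B` at primes regular: `B` is a flat `A`-module (Matsumura 23.1 at each
prime, the dimension equality coming from going-down for rings of invariants and integrality, the fibre condition
from quasi-finiteness). [cite: Matsumura1987, Thm. 23.1] [cite: LipmanHashimoto2009, Part II Lemma 32.2 (PDF p.437)] -/
theorem flat_of_isInvariant_of_isRegularLocalRing {A B : Type u} [CommRing A] [CommRing B] [Algebra A B]
    (G : Type u) [Group G] [Finite G] [MulSemiringAction G B] [SMulCommClass G A B]
    [Algebra.IsInvariant A B G] [FaithfulSMul A B] [Module.Finite A B] [IsNoetherianRing B]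
    (hA : ∀ (p : Ideal A) [p.IsPrime], IsRegularLocalRing (Localization.AtPrime p))
    (hB : ∀ (q : Ideal B) [q.IsPrime], IsRegularLocalRing (Localization.AtPrime q)) :
    Module.Flat A B := by
  haveI : Algebra.IsIntegral A B := Algebra.IsInvariant.isIntegral A B G
  haveI : Algebra.HasGoingDown A B := IntegralClosure.InvariantGoingDown.hasGoingDown (A := A) (B := B) G
  rw [← RingHom.flat_algebraMap_iff]
  refine RingHom.Flat.ofLocalizationPrime (algebraMap A B) fun q hq => ?_
  -- at the prime `q` of `B` over `p = q ∩ A`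
  set p : Ideal A := q.comap (algebraMap A B) with hp
  haveI : q.LiesOver p := ⟨hp⟩
  haveI := hA p
  haveI := hB q
  letI : Algebra (Localization.AtPrime p) (Localization.AtPrime q) :=
    (Localization.localRingHom p q (algebraMap A B) rfl).toAlgebra
  haveI : Localization.AtPrime.IsLiesOverAlgebra p q := ⟨rfl⟩
  haveI : IsLocalHom (algebraMap (Localization.AtPrime p) (Localization.AtPrime q)) :=
    inferInstanceAs (IsLocalHom (Localization.localRingHom p q (algebraMap A B) rfl))
  -- `dim B_q = ht q = ht p = dim A_p` (going-down for rings of invariants + integrality)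
  have hdim : ringKrullDim (Localization.AtPrime q) = ringKrullDim (Localization.AtPrime p) := by
    rw [IsLocalization.AtPrime.ringKrullDim_eq_height q (Localization.AtPrime q),
      IsLocalization.AtPrime.ringKrullDim_eq_height p (Localization.AtPrime p)]
    exact congrArg _ (KrullDimension.height_under_eq (R := A) q).symm
  -- `p B_q` is primary for the maximal ideal (quasi-finiteness)
  have hprim := Literature.AlgebraicGeometry.Morphisms.exists_maximalIdeal_pow_le_map_of_quasiFinite
    (R := A) (S := B) p q (A := Localization.AtPrime p) (B := Localization.AtPrime q)
  exact flat_of_isRegularLocalRing_of_maximalIdeal_pow_le hdim hprim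

end Literature.RingTheory.Flat

end
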